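import Mathlib.Tactic
import HarnessLib

/-!
# Kozma–Nitzan's Question 8 — the (Q-A) reduction for blocks with several positive depths (gen 33)

Support file (`--supports stmt-CriticalPhenomena-4575`, closed crux; independent mathematics on Kozma–Nitzan's Question 8,
arXiv:2401.12397 §5.5 p. 36), prover `prim-ineq-gen-6` (gen 33).  No definitions, no named facts, no sorries; standard axioms.
Memo `run/shared/lean/prim/prim-ineq-gen-6/FINDING-G33.md` §2.

For a path-end block whose positive emission region has depths `0..i` (`k₁ = i+1`), the corner condition (Q-A) at a hypothesis depth `d`
(`Pg_d > 0`) is reduced to two structural statements (THEOREM QA-GEN of the memo): no crossing of the sub-root `b_i` before `d`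
(CONJECTURE UNIF-I / UNIF-G′) and the LEMMA-J-type bound `JL′ ≤ c`.  This file certifies the real-arithmetic cores:
`kQAgen_core` (the reduction itself, with abstract finite index sets), `kJL_term` (the LEMMA-J chain at one positive depth:
emission bound × budget bound), `kJL_last` (the scalar showing the last term of `JL′` is at most `c`), and
`kJL_telescope` (the weights `(1−s_{j+1})·s_{j+2}⋯s_{i+1}` of the earlier terms sum to `1 − s₁⋯s_{i+1}`).
[cite: KozmaNitzan2024, Question 8 (§5.5 p. 36)]
-/

namespace Summit.CriticalPhenomena.PercolationContinuityZ3.Theorems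

namespace PocketCert

open Finset

/-- **THEOREM QA-GEN, core.**  Positive depths `J` (emissions `g_j ≥ 0`, levels `θ_j`), kill depths `L` (`g_l ≤ 0`) whose levels are
at most `Θ ≥ 0` (no sub-root crossing: `θ_l ≤ θ_i(1+λ_i) =: Θ`), and the hypothesis `Σ_J g + Σ_L g > 0` (`Pg_d > 0`).  Then
`Qa_d = Σ_J θ g + Σ_L θ g ≥ −Σ_J g·(Θ − θ_j)⁺ = −JL′`.
[cite: KozmaNitzan2024, Question 8 (§5.5 p. 36)] -/
theorem kQAgen_core (J L : Finset ℕ) (θ g : ℕ → ℝ) (Θ : ℝ) (hΘ : 0 ≤ Θ)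
    (hgJ : ∀ j ∈ J, 0 ≤ g j) (hgL : ∀ l ∈ L, g l ≤ 0) (hθL : ∀ l ∈ L, θ l ≤ Θ)
    (hyp : 0 < ∑ j ∈ J, g j + ∑ l ∈ L, g l) :
    -(∑ j ∈ J, g j * max (Θ - θ j) 0) ≤ ∑ j ∈ J, θ j * g j + ∑ l ∈ L, θ l * g l := by
  -- kills: θ_l g_l ≥ Θ g_l termwise
  have hL : Θ * ∑ l ∈ L, g l ≤ ∑ l ∈ L, θ l * g l := by
    rw [Finset.mul_sum]
    apply Finset.sum_le_sum
    intro l hl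
    have h1 := hgL l hl
    have h2 := hθL l hl
    nlinarith
  -- hypothesis: Σ_L g ≥ −Σ_J g, times Θ ≥ 0
  have hL2 : -(Θ * ∑ j ∈ J, g j) ≤ Θ * ∑ l ∈ L, g l := by nlinarith
  -- positives: θ_j g_j − Θ g_j ≥ −g_j (Θ − θ_j)⁺
  have hJ : -(∑ j ∈ J, g j * max (Θ - θ j) 0) ≤ ∑ j ∈ J, θ j * g j - Θ * ∑ j ∈ J, g j := by
    rw [Finset.mul_sum, ← Finset.sum_sub_distrib, ← Finset.sum_neg_distrib]
    apply Finset.sum_le_sum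
    intro j hj
    have hg := hgJ j hj
    have hm : Θ - θ j ≤ max (Θ - θ j) 0 := le_max_left _ _
    nlinarith [mul_le_mul_of_nonneg_left hm hg]
  linarith

/-- **The LEMMA-J chain at one positive depth** (memo §2(c)(1)–(3)), product form.  With the emission bound
`g·p ≤ (1−s)·v·γ·N` (from `|Ũ_j| ≤ v(Γ_ju − R̃_j)`, `R̃_j ≥ γ_ja_jK₄`) and the budget bound `S·v·γ·N ≤ c·Φ`
(from `cΦ = D·ϖ`, `D ≥ S a v`, `ϖ ≥ γN/a`), `a, Φ, S ≥ 0`, `s ≤ 1`: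
`(a²ΦS)·g·p·Φ ≤ (1−s)a²Φ²·(cΦ)`, i.e. `θλg ≤ c·(1−s)a²Φ²/(γ(Φ+m)p)` after dividing by `γ(Φ+m)pΦ` (`θ = a/γ`, `λ = aΦS/(Φ+m)`).
[cite: KozmaNitzan2024, Question 8 (§5.5 p. 36)] -/
theorem kJL_term (a Φ S s v N g c p γ : ℝ) (ha : 0 ≤ a) (hΦ : 0 ≤ Φ) (hS : 0 ≤ S) (hs1 : s ≤ 1)
    (hg : g * p ≤ (1 - s) * v * γ * N) (hc : S * v * γ * N ≤ c * Φ) :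
    (a * a * Φ * S) * g * p * Φ ≤ (1 - s) * a * a * Φ * Φ * (c * Φ) := by
  have h1 : (a * a * Φ * S) * (g * p) ≤ (a * a * Φ * S) * ((1 - s) * v * γ * N) :=
    mul_le_mul_of_nonneg_left hg (by positivity)
  have hs0 : 0 ≤ 1 - s := by linarith
  have h2 : ((1 - s) * a * a * Φ * Φ) * (S * v * γ * N) ≤ ((1 - s) * a * a * Φ * Φ) * (c * Φ) :=
    mul_le_mul_of_nonneg_left hc (by positivity)
  have e1 : (a * a * Φ * S) * g * p * Φ = ((a * a * Φ * S) * (g * p)) * Φ := by ring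
  have e2 : (a * a * Φ * S) * ((1 - s) * v * γ * N) * Φ = ((1 - s) * a * a * Φ * Φ) * (S * v * γ * N) := by ring
  rw [e1]
  have h3 := mul_le_mul_of_nonneg_right h1 hΦ
  rw [e2] at h3
  linarith

/-- **The last term of JL′ is at most `c`** (memo §2(c)(3)): for `0 ≤ a ≤ 1`, `0 ≤ S ≤ s ≤ 1`, the positive-region bound
`γ ≥ 1 − a²S/3` (PROOF-SSC-U REMARK (iv)) and `0 ≤ Φ ≤ p`, `m ≥ 0`:  `(1−s)·a²·Φ² ≤ γ·(Φ+m)·p`.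
With `kJL_term`: `θ_iλ_ig_i ≤ c·(1−s_{i+1})a_i²Φ²/(γ_i(Φ+m)p_i) ≤ c`.
[cite: KozmaNitzan2024, Question 8 (§5.5 p. 36)] -/
theorem kJL_last (a S s γ Φ p m : ℝ) (ha0 : 0 ≤ a) (ha1 : a ≤ 1) (hS0 : 0 ≤ S) (hSs : S ≤ s) (hs1 : s ≤ 1)
    (hγ : 1 - a ^ 2 * S / 3 ≤ γ) (hΦ0 : 0 ≤ Φ) (hΦp : Φ ≤ p) (hm : 0 ≤ m) :
    (1 - s) * a ^ 2 * Φ ^ 2 ≤ γ * (Φ + m) * p := by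
  have ha2 : a ^ 2 ≤ 1 := by nlinarith
  have hS1 : S ≤ 1 := le_trans hSs hs1
  have h1 : (1 - s) * a ^ 2 ≤ 1 - a ^ 2 * S / 3 := by
    nlinarith [mul_nonneg (sq_nonneg a) hS0, mul_le_mul_of_nonneg_left hSs (sq_nonneg a)]
  have h2 : (1 - s) * a ^ 2 ≤ γ := le_trans h1 hγ
  have hp0 : 0 ≤ p := le_trans hΦ0 hΦp
  have h3 : Φ ^ 2 ≤ (Φ + m) * p := by nlinarith [mul_le_mul hΦp hΦp hΦ0 hp0]
  have hγ0 : 0 ≤ γ := by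
    have : 0 ≤ 1 - a ^ 2 * S / 3 := by nlinarith [mul_le_mul ha2 hS1 hS0 (by norm_num : (0:ℝ) ≤ 1)]
    linarith
  calc (1 - s) * a ^ 2 * Φ ^ 2 ≤ γ * Φ ^ 2 := mul_le_mul_of_nonneg_right h2 (sq_nonneg Φ)
    _ ≤ γ * ((Φ + m) * p) := mul_le_mul_of_nonneg_left h3 hγ0
    _ = γ * (Φ + m) * p := by ring

/-- **Telescoping of the positive-region weights** (memo §2(c),(g)): for edge weights `t 0, t 1, …` (`t j = s_{j+1}`),
`Σ_{j<n} (1 − t j)·∏_{j<r<n} t r = 1 − ∏_{r<n} t r` — the law of the last closed edge among `e₁,…,e_n`.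
[cite: KozmaNitzan2024, Question 8 (§5.5 p. 36)] -/
theorem kJL_telescope (t : ℕ → ℝ) (n : ℕ) :
    ∑ j ∈ range n, (1 - t j) * ∏ r ∈ Ico (j + 1) n, t r = 1 - ∏ r ∈ range n, t r := by
  induction n with
  | zero => simp
  | succ n ih =>
    rw [Finset.sum_range_succ, Finset.prod_range_succ]
    have hlast : ∏ r ∈ Ico (n + 1) (n + 1), t r = 1 := by simp
    rw [hlast, mul_one]
    have hsplit : ∀ j ∈ range n, (1 - t j) * ∏ r ∈ Ico (j + 1) (n + 1), t r
        = ((1 - t j) * ∏ r ∈ Ico (j + 1) n, t r) * t n := by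
      intro j hj
      have hjn : j + 1 ≤ n := by
        have := Finset.mem_range.mp hj
        omega
      rw [Finset.prod_Ico_succ_top hjn]
      ring
    rw [Finset.sum_congr rfl hsplit, ← Finset.sum_mul, ih]
    ring

end PocketCert

end Summit.CriticalPhenomena.PercolationContinuityZ3.Theorems
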